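import Literature.NumberTheory.Automorphic.BrandtModuleResidueRamifiedSq
import HarnessLib

/-!
# Residual classification VI: `|Z| = p³` is impossible; the split/ramified dichotomy

Twelfth layer of the proof files for the named fact `brandtMatrix_comm` of `BrandtModule.lean`
(Vignéras, LNM 800, III §5 ex. 5.8; Eichler 1973, II §6 Thm. 2). Finishing the residual
classification of a **maximal** order `O` at a prime `p` (`A = O / p O`, no non-trivial
idempotents, norm lattice `𝔓` with image `Z ⊆ A`):

* `exists_socle_normResidue` — a **socle element**: `w ∈ Z`, `w ≠ 0`, `Z w = w Z = 0` (take
  `w ≠ 0` with the largest left annihilator in `Z`; by anti-commutativity `z w ≠ 0` or `w z ≠ 0`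
  would produce a strictly larger one);
* `exists_sub_intCast_mem_of_card_cube` — if `|Z| = p³` then `A = ℤ · 1 + Z`;
* `IsMaximalZOrder.card_normResidue_ne_cube` — **`|Z| = p³` is impossible**: lift `w` to
  `w̃ ∈ 𝔓`, `n(w̃) = p m`. If `p ∤ m`, then `w̃̄ 𝔓 ⊆ p O` gives `m 𝔓 ⊆ w̃ O`, i.e. `Z ⊆ 𝔽_p w`,
  too small; if `p ∣ m`, the two-sided lattice `𝔄 = ℤ w̃ + p O` has `w̃ 𝔄 ⊆ p 𝔄`, and (M1)
  (`IsMaximalZOrder.mem_smul_of_mul_le`) forces `w̃ ∈ p O`, i.e. `w = 0`;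
* `IsMaximalZOrder.residuallySplit_or_ramified` — **the dichotomy**: a maximal order is residually
  split or residually ramified at every prime (Vignéras II §1–§2: `O_p ≅ M₂(ℤ_p)` or the maximal
  order of the division algebra), obtained here from maximality alone.

## References

* M.-F. Vignéras, *Arithmétique des algèbres de quaternions*, LNM 800 (1980), Ch. II §1
  Thm. 1.1, Lemme 1.5; §2 Thm. 2.3 [VignerasLNM800].
-/

noncomputable section

open scoped Pointwise

universe u

namespace Literature.NumberTheory.Automorphic

namespace IsZOrder

variable {B : Type u} [Ring B] [Algebra ℚ B] [IsQuaternionAlgebra ℚ B] {O : Submodule ℤ B} {p : ℕ}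
  {hO : IsZOrder O} {hH : ∀ x : hO.subring, (p : ℤ) ∣ nrdZ (x : B) → (p : ℤ) ∣ trdZ (x : B)}

/-! ### A socle element of `Z` -/

/-- **A socle element**: there is `w ∈ Z`, `w ≠ 0`, with `z w = w z = 0` for all `z ∈ Z`. Take
`w ≠ 0` in `Z` maximising the size of its left annihilator in `Z`; if `z w ≠ 0` then `z w` has a
strictly larger one (it contains the old one by anti-commutativity, and `z`), and similarly for
`w z ≠ 0`. [folklore] -/
theorem exists_socle_normResidue (hp : p.Prime) :
    ∃ w ∈ hO.normResidue p hH, w ≠ 0 ∧ ∀ z ∈ hO.normResidue p hH, z * w = 0 ∧ w * z = 0 := by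
  classical
  haveI := hO.finite_residue hp.ne_zero
  letI : Fintype (hO.Residue p) := Fintype.ofFinite _
  set Z := hO.normResidue p hH
  let S : Finset (hO.Residue p) := Finset.univ.filter fun w => w ∈ Z ∧ w ≠ 0
  have hS : S.Nonempty := by
    obtain ⟨x, hx0, hdvd⟩ := hO.exists_res_ne_zero_dvd_nrdZ hp
    exact ⟨hO.res p x, Finset.mem_filter.mpr ⟨Finset.mem_univ _,
      res_mem_normResidue_iff.mpr ⟨x.2, hdvd⟩, hx0⟩⟩
  let L : hO.Residue p → ℕ := fun w => (Finset.univ.filter fun x => x ∈ Z ∧ x * w = 0).card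
  obtain ⟨w, hwS, hmax⟩ := Finset.exists_max_image S L hS
  obtain ⟨hwZ, hw0⟩ := (Finset.mem_filter.mp hwS).2
  -- a `w'` whose left annihilator contains that of `w` and some `z` with `z w ≠ 0` beats `w`
  have key : ∀ w' ∈ Z, w' ≠ 0 → (∀ x ∈ Z, x * w = 0 → x * w' = 0) →
      ∀ z ∈ Z, z * w' = 0 → z * w ≠ 0 → False := by
    intro w' hw' hw'0 hsub z hz hzw' hzw
    have hlt : L w < L w' := by
      apply Finset.card_lt_card
      refine (Finset.ssubset_iff_of_subset fun x hx => ?_).mpr ⟨z, ?_, ?_⟩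
      · simp only [Finset.mem_filter, Finset.mem_univ, true_and] at hx ⊢
        exact ⟨hx.1, hsub x hx.1 hx.2⟩
      · simp only [Finset.mem_filter, Finset.mem_univ, true_and]; exact ⟨hz, hzw'⟩
      · simp only [Finset.mem_filter, Finset.mem_univ, true_and, not_and]; exact fun _ => hzw
    exact absurd (hmax w' (Finset.mem_filter.mpr ⟨Finset.mem_univ _, hw', hw'0⟩)) (not_le.mpr hlt)
  refine ⟨w, hwZ, hw0, fun z hz => ⟨?_, ?_⟩⟩
  · by_contra hzw
    refine key (z * w) (mul_mem_normResidue z hwZ).1 hzw (fun x hx hxw => ?_) z hz ?_ hzw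
    · have h := mul_add_mul_swap_of_mem_normResidue hp hx hz
      calc x * (z * w) = (x * z + z * x) * w - z * (x * w) := by noncomm_ring
        _ = 0 := by rw [h, hxw, zero_mul, mul_zero, sub_zero]
    · rw [← mul_assoc, mul_self_of_mem_normResidue hp hz, zero_mul]
  · by_contra hwz
    have hzw : z * w ≠ 0 := fun h => hwz (by
      have := mul_add_mul_swap_of_mem_normResidue hp hz hwZ
      rwa [h, zero_add] at this)
    refine key (w * z) (mul_mem_normResidue z hwZ).2 hwz (fun x _ hxw => ?_) z hz ?_ hzw
    · rw [← mul_assoc, hxw, zero_mul]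
    · have h := mul_add_mul_swap_of_mem_normResidue hp hz hwZ
      calc z * (w * z) = (z * w + w * z) * z - w * (z * z) := by noncomm_ring
        _ = 0 := by rw [h, mul_self_of_mem_normResidue hp hz, zero_mul, mul_zero, sub_zero]

/-! ### `|Z| = p³`: `A = ℤ · 1 + Z` -/

/-- If `|Z| = p³` then every `a ∈ A` is an integer plus an element of `Z` (`Z + ℤ · 1` is a
subgroup strictly larger than `Z`, hence all of `A`). [folklore] -/
theorem exists_sub_intCast_mem_of_card_cube (hp : p.Prime) (hcard : Nat.card (hO.normResidue p hH) = p ^ 3)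
    (a : hO.Residue p) : ∃ k : ℤ, a - (k : hO.Residue p) ∈ hO.normResidue p hH := by
  haveI := hO.finite_residue hp.ne_zero
  set Z := hO.normResidue p hH
  set Z' := Z ⊔ AddSubgroup.zmultiples (1 : hO.Residue p)
  have hle : Z ≤ Z' := le_sup_left
  have h1 : (1 : hO.Residue p) ∈ Z' := (le_sup_right : _ ≤ Z') (AddSubgroup.mem_zmultiples (1 : hO.Residue p))
  have hne : Z ≠ Z' := fun h => by
    rw [← h] at h1
    exact one_not_mem_normResidue hp h1
  obtain ⟨i, -, hi⟩ := hO.card_addSubgroup_residue hp Z'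
  have hdvd : p ^ 3 ∣ p ^ i := by
    rw [← hcard, ← hi]; exact AddSubgroup.card_dvd_of_le hle
  have hi3 : 3 ≤ i := (Nat.pow_dvd_pow_iff_le_right hp.one_lt).mp hdvd
  have hne3 : i ≠ 3 := fun h => hne (AddSubgroup.eq_of_le_of_card_ge hle (by rw [hi, h, hcard]))
  obtain ⟨j, hj4, hj⟩ := hO.card_addSubgroup_residue hp Z'
  have hij : i = j := Nat.pow_right_injective hp.two_le (hi.symm.trans hj)
  have hi4 : i = 4 := by omega
  have htop : Z' = ⊤ := (AddSubgroup.card_eq_iff_eq_top Z').mp (by rw [hi, hi4, hO.card_residue hp.ne_zero])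
  have ha : a ∈ Z' := htop ▸ AddSubgroup.mem_top a
  obtain ⟨y, hy, k', hk', hyk⟩ := AddSubgroup.mem_sup.mp ha
  obtain ⟨k, rfl⟩ := AddSubgroup.mem_zmultiples_iff.mp hk'
  refine ⟨k, ?_⟩
  rw [← hyk, zsmul_eq_mul, mul_one, add_sub_cancel_right]
  exact hy

/-! ### `|Z| = p³` is impossible for a maximal order -/

/-- **`|Z| = p³` cannot happen for a maximal order.** [cite: VignerasLNM800, Ch. II §1 Thm. 1.1, Lemme 1.5
(`[O : P] = p²` for the maximal order of the local division algebra); §2 Thm. 2.3] -/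
theorem _root_.Literature.NumberTheory.Automorphic.IsMaximalZOrder.card_normResidue_ne_cube
    {hO : IsZOrder O} {hH : ∀ x : hO.subring, (p : ℤ) ∣ nrdZ (x : B) → (p : ℤ) ∣ trdZ (x : B)}
    (hmax : IsMaximalZOrder O) (hp : p.Prime) : Nat.card (hO.normResidue p hH) ≠ p ^ 3 := by
  intro hcard
  haveI : IsAddTorsionFree B := isAddTorsionFree_of_charZero_module ℚ B
  haveI : Fact p.Prime := ⟨hp⟩
  have hpZ : (p : ℤ) ≠ 0 := by exact_mod_cast hp.ne_zero
  have hp0 : ((p : ℤ) : hO.Residue p) = 0 := (hO.intCast_residue_eq_zero_iff hp).mpr (dvd_refl _)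
  set Z := hO.normResidue p hH
  obtain ⟨w, hwZ, hw0, hsoc⟩ := exists_socle_normResidue (hO := hO) (hH := hH) hp
  obtain ⟨ws, hws, hres⟩ := mem_normResidue_iff.mp hwZ
  obtain ⟨-, hn⟩ := hws
  obtain ⟨m, hm⟩ := hn
  obtain ⟨t', ht'⟩ := hH ws ⟨m, hm⟩
  have hdec := exists_sub_intCast_mem_of_card_cube (hO := hO) (hH := hH) hp hcard
  -- `w · res c = k w` where `res c = k + z''`
  have hwc : ∀ c : hO.subring, ∃ k : ℤ, w * hO.res p c = (k : hO.Residue p) * w := fun c => by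
    obtain ⟨k, hk⟩ := hdec (hO.res p c)
    refine ⟨k, ?_⟩
    calc w * hO.res p c = w * (hO.res p c - k) + w * (k : hO.Residue p) := by rw [mul_sub, sub_add_cancel]
      _ = (k : hO.Residue p) * w := by rw [(hsoc _ hk).2, zero_add, (Int.cast_commute k w).eq]
  by_cases hpm : (p : ℤ) ∣ m
  · -- (M1) with `𝔄 = ℤ w̃ + p O`
    obtain ⟨m', rfl⟩ := hpm
    obtain ⟨𝔄, hmem𝔄⟩ : ∃ 𝔄 : Submodule ℤ B, ∀ a, a ∈ 𝔄 ↔ ∃ k : ℤ, a - k • (ws : B) ∈ (p : ℤ) • O :=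
      ⟨{ carrier := {a | ∃ k : ℤ, a - k • (ws : B) ∈ (p : ℤ) • O}
         add_mem' := by
           rintro a b ⟨k, hk⟩ ⟨l, hl⟩
           refine ⟨k + l, ?_⟩
           have : a + b - (k + l) • (ws : B) = (a - k • (ws : B)) + (b - l • (ws : B)) := by
             rw [add_smul]; abel
           rw [this]
           exact Submodule.add_mem _ hk hl
         zero_mem' := ⟨0, by rw [zero_smul, sub_zero]; exact Submodule.zero_mem _⟩
         smul_mem' := by
           rintro c a ⟨k, hk⟩
           refine ⟨c * k, ?_⟩
           rw [mul_smul, ← smul_sub]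
           exact Submodule.smul_mem _ _ hk }, fun _ => Iff.rfl⟩
    have hlow : (p : ℤ) • O ≤ 𝔄 := fun a ha => (hmem𝔄 a).mpr ⟨0, by rwa [zero_smul, sub_zero]⟩
    have hup : 𝔄 ≤ O := fun a ha => by
      obtain ⟨k, hk⟩ := (hmem𝔄 a).mp ha
      have : a = (a - k • (ws : B)) + k • (ws : B) := by abel
      rw [this]
      exact O.add_mem (smul_le O _ hk) (O.smul_mem _ ws.2)
    -- `x w̃ ∈ 𝔄` and `w̃ x ∈ 𝔄` for `x ∈ O`
    have hxw : ∀ x ∈ O, x * ws ∈ 𝔄 ∧ (ws : B) * x ∈ 𝔄 := fun x hx => by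
      obtain ⟨k, hk⟩ := hdec (hO.res p ⟨x, hx⟩)
      constructor
      · refine (hmem𝔄 _).mpr ⟨k, ?_⟩
        have h : hO.res p (⟨x, hx⟩ * ws - (k : hO.subring) * ws) = 0 := by
          rw [map_sub, map_mul, map_mul, map_intCast, hres]
          calc hO.res p ⟨x, hx⟩ * w - (k : hO.Residue p) * w = (hO.res p ⟨x, hx⟩ - k) * w := by rw [sub_mul]
            _ = 0 := (hsoc _ hk).1
        have := res_eq_zero_iff.mp h
        simpa only [AddSubgroupClass.coe_sub, Subring.coe_mul, Subring.coe_intCast, zsmul_eq_mul] using this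
      · obtain ⟨k', hk'⟩ := hwc ⟨x, hx⟩
        refine (hmem𝔄 _).mpr ⟨k', ?_⟩
        have h : hO.res p (ws * ⟨x, hx⟩ - (k' : hO.subring) * ws) = 0 := by
          rw [map_sub, map_mul, map_mul, map_intCast, hres, hk', sub_self]
        have := res_eq_zero_iff.mp h
        simpa only [AddSubgroupClass.coe_sub, Subring.coe_mul, Subring.coe_intCast, zsmul_eq_mul] using this
    have hleft : ∀ x ∈ O, ∀ a ∈ 𝔄, x * a ∈ 𝔄 := fun x hx a ha => by
      obtain ⟨k, hk⟩ := (hmem𝔄 a).mp ha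
      have : x * a = x * (a - k • (ws : B)) + k • (x * ws) := by rw [mul_sub, mul_smul_comm, sub_add_cancel]
      rw [this]
      exact 𝔄.add_mem (hlow (hO.mul_smul_mem hx hk)) (𝔄.smul_mem _ (hxw x hx).1)
    have hsmul𝔄 : ∀ {b : B}, b ∈ 𝔄 → (p : ℤ) • b ∈ (p : ℤ) • 𝔄 := fun hb =>
      Submodule.smul_mem_pointwise_smul _ _ _ hb
    -- `w̃² = p • (t' w̃ − p m' · 1) ∈ p 𝔄`
    have hsq : (ws : B) * ws ∈ (p : ℤ) • 𝔄 := by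
      rw [hO.mul_self_eq_trdZ ws.2, ht', hm, show ((p : ℤ) * t') • (ws : B) - ((p : ℤ) * ((p : ℤ) * m')) • (1 : B)
        = (p : ℤ) • (t' • (ws : B) - ((p : ℤ) * m') • (1 : B)) by rw [smul_sub, ← mul_smul, ← mul_smul]]
      refine hsmul𝔄 ((hmem𝔄 _).mpr ⟨t', ?_⟩)
      rw [sub_sub_cancel_left, mul_smul]
      exact Submodule.neg_mem _ (Submodule.smul_mem_pointwise_smul _ _ O (O.smul_mem _ hO.one_mem))
    have hy : ∀ a ∈ 𝔄, (ws : B) * a ∈ (p : ℤ) • 𝔄 := fun a ha => by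
      obtain ⟨k, hk⟩ := (hmem𝔄 a).mp ha
      obtain ⟨o, ho, hao⟩ := (Submodule.mem_smul_pointwise_iff_exists _ _ O).mp hk
      have : (ws : B) * a = k • ((ws : B) * ws) + (p : ℤ) • ((ws : B) * o) := by
        have ha' : a = k • (ws : B) + (p : ℤ) • o := by rw [hao]; abel
        rw [ha', mul_add, mul_smul_comm, mul_smul_comm]
      rw [this]
      exact Submodule.add_mem _ (Submodule.smul_mem _ _ hsq) (hsmul𝔄 (hxw o ho).2)
    have hmem : (ws : B) ∈ (p : ℤ) • O := hmax.mem_smul_of_mul_le hpZ hlow hup hleft hpZ hy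
    exact hw0 (by rw [← hres, res_eq_zero_iff]; exact hmem)
  · -- `m 𝔓 ⊆ w̃ O`: `Z ⊆ 𝔽_p w`
    obtain ⟨l, hl⟩ := hO.exists_intCast_mul_eq_one hp hpm
    have hline : Z ≤ AddSubgroup.zmultiples w := fun z hz => by
      obtain ⟨zs, hzs, rfl⟩ := mem_normResidue_iff.mp hz
      -- `w̃̄ z̃ ∈ p O`
      have hbar : hO.res p (hO.barS ws * zs) = 0 := by
        rw [map_mul, hO.res_barS, ht', Int.cast_mul, hp0, zero_mul, zero_sub, hres, neg_mul,
          (hsoc _ hz).2, neg_zero]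
      obtain ⟨c, hc, hcc⟩ := (Submodule.mem_smul_pointwise_iff_exists _ _ O).mp (res_eq_zero_iff.mp hbar)
      -- `m z̃ = w̃ c`
      have hmz : (m : ℤ) • (zs : B) = ws * c := by
        apply smul_right_injective B hpZ
        change (p : ℤ) • ((m : ℤ) • (zs : B)) = (p : ℤ) • ((ws : B) * c)
        rw [← mul_smul_comm, hcc, ← mul_smul, ← hm]
        have h := congrArg (fun y : hO.subring => (y : B)) (hO.mul_barS ws)
        simp only [Subring.coe_mul, Subring.coe_intCast] at h
        rw [Subring.coe_mul, ← mul_assoc, h, zsmul_eq_mul]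
      obtain ⟨k, hk⟩ := hwc ⟨c, hc⟩
      have hres_mz : (m : hO.Residue p) * hO.res p zs = (k : hO.Residue p) * w := by
        rw [← hk, ← hres, ← map_mul, ← map_intCast (hO.res p), ← map_mul]
        congr 1
        apply Subtype.ext
        simp only [Subring.coe_mul, ← zsmul_eq_mul]
        exact hmz
      refine AddSubgroup.mem_zmultiples_iff.mpr ⟨l * k, ?_⟩
      calc (l * k) • w = (l : hO.Residue p) * ((k : hO.Residue p) * w) := by
            rw [zsmul_eq_mul, Int.cast_mul, mul_assoc]
        _ = (l : hO.Residue p) * (m : hO.Residue p) * hO.res p zs := by rw [← hres_mz, mul_assoc]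
        _ = hO.res p zs := by rw [hl, one_mul]
    have hord : addOrderOf w = p :=
      addOrderOf_eq_prime (by rw [nsmul_eq_mul, natCast_self_residue, zero_mul]) hw0
    haveI : Finite (AddSubgroup.zmultiples w) := Nat.finite_of_card_ne_zero (by
      rw [Nat.card_zmultiples, hord]; exact hp.ne_zero)
    have hle := AddSubgroup.card_le_of_le hline
    rw [hcard, Nat.card_zmultiples, hord] at hle
    exact absurd hle (not_le.mpr (lt_self_pow₀ (by exact_mod_cast hp.one_lt) (by norm_num)))

/-! ### The dichotomy -/

/-- Without non-trivial idempotents in `A`, a maximal order is residually ramified at `p`.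
[cite: VignerasLNM800, Ch. II §1 Thm. 1.1, Lemme 1.5] -/
theorem _root_.Literature.NumberTheory.Automorphic.IsMaximalZOrder.isResiduallyRamified_of_no_idempotent
    (hO : IsZOrder O) (hmax : IsMaximalZOrder O) (hp : p.Prime)
    (hno : ∀ e : hO.Residue p, IsIdempotentElem e → e = 0 ∨ e = 1) : hO.IsResiduallyRamified p := by
  have hH := hO.dvd_trdZ_of_no_idempotent hp hno
  obtain ⟨i, hi1, hi3, hi⟩ := card_normResidue_cases (hO := hO) (hH := hH) hp
  interval_cases i
  · exact absurd ((pow_one p) ▸ hi) (card_normResidue_ne hp)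
  · exact hmax.isResiduallyRamified_of_card_sq hp hi
  · exact absurd hi (hmax.card_normResidue_ne_cube hp)

/-- **The residual dichotomy for maximal orders**: at every prime `p`, a maximal order is
residually split (`O / p O ≅ M₂(𝔽_p)`, witnessed by matrix units) or residually ramified
(`𝔓² = p O`, `O / 𝔓` a division ring of order `p²`). [cite: VignerasLNM800, Ch. II §1 Thm. 1.1, §2 Thm. 2.3] -/
theorem _root_.Literature.NumberTheory.Automorphic.IsMaximalZOrder.residuallySplit_or_ramified
    (hO : IsZOrder O) (hmax : IsMaximalZOrder O) (hp : p.Prime) :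
    hO.IsResiduallySplit p ∨ hO.IsResiduallyRamified p := by
  by_cases h : ∃ e : hO.Residue p, IsIdempotentElem e ∧ e ≠ 0 ∧ e ≠ 1
  · obtain ⟨e, he, h0, h1⟩ := h
    obtain ⟨x, rfl⟩ := hO.res_surjective p e
    exact Or.inl (hmax.isResiduallySplit_of_idempotent hO hp he h0 h1)
  · push Not at h
    refine Or.inr (hmax.isResiduallyRamified_of_no_idempotent hO hp fun e he => ?_)
    by_cases h0 : e = 0
    · exact Or.inl h0
    · exact Or.inr (h e he h0)

end IsZOrder

end Literature.NumberTheory.Automorphic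

end
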